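import Mathlib
import Literature.MathematicalPhysics.QuantumFieldTheory.Balaban1983to89.B5Projector144

/-! # `Balaban1983to89.B9Eq325Proj` — B9 p. 394, (3.20)–(3.25): the gauge-fixing operator R = I − G′Q′\*(Q′G′²Q′\*)⁻¹Q′G′
IS the orthogonal projection onto Δ^η_U N(Q′), with the (3.22) minimiser — kernel-checked, for LEVEL-DEPENDENT a

CITATION HEADER.  Paper sub-cell `b2b-balaban-b09` (gen 6, journal claim SHARPEN T06.1 setup (3.20)–(3.25) pass 6 ∕
C-B9-27-R325, cell pub-balaban) on T. Balaban, *Propagators for lattice gauge theories in a background field*, Commun.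
Math. Phys. 99 (1985) 389–434 [`Balaban1985BackgroundPropagators`] (= B9), Sect. 3 set-up, pp. 393–394 [PDF 5–6]
(renders `b2b-balaban-ref1/pages/1985-cmp99-background-propagators/…-p005-x2.png`, `…-p006-x2.png`, read as images).

WHAT IS PRINTED (verbatim).
* p. 393, (3.17): *"We define a gauge fixing density by the expression
  exp(−(1/2α)‖D\*A‖²)(Z′^{−1}∫dλ δ(Q′λ)exp(−(1/2α)‖D\*A^λ‖²))^{−1}, (3.17)"* (A^λ = A − Dλ), and *"The norm ‖·‖ in (3.17)
  is determined by the scalar product ⟨λ, λ′⟩ = Σ_{x∈Ω₀} η^d tr λ(x)λ′(x) in the Hilbert space L²(Ω₀, 𝔤)."*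
* p. 394: *"The integral in (3.17) can be calculated in the same way as in [3], (1.42)–(1.44), and we get
  (3.17) = exp(−(1/2α)‖RD\*A‖²), (3.20) where R = R(U) is an orthogonal projection in the Hilbert space L²(Ω₀, 𝔤) onto
  the subspace R = Δ^η_U N(Q′), N(Q′) = {λ : Q′λ = 0}. (3.21) For an arbitrary function f∈L²(Ω₀, 𝔤) we have Rf = Δ^η_U λ₀,
  where λ₀ is a minimum of the function λ∈N(Q′), λ → ‖f − Δ^η_U λ‖². (3.22) In the above formulas Δ_U is the covariant
  Laplce operator Δ^η_U = D^η\*_U D^η_U = Σ_{μ=1}^{d} D^η\*_{U,μ}D^η_{U,μ}. (3.23) Let us introduce the operator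
  Δ′_a = Δ′_a(U) = (Δ^η_U + Q′\*aQ′)↾_{Ω₀}, where Q′\*aQ′ is defined by the same quadratic form as in (2.14), i.e.
  ⟨λ, Q′\*aQ′λ⟩ = Σ_{j=0}^{k} a_j Σ_{y∈Λ_j} (L^jη)^{d−2}|(Q′_j(U)λ)(y)|², (3.24) the numbers a_j satisfy the recursive
  equations a_{j+1} = aa_j/(aL^{−2} + a_j), a₁ = a₀ = a > 0."* … *"Its inverse is denoted by G′, or G′(U)."* …
  *"Using the Lagrange multipliers method the minimum of (3.22) can be found by the same calculations as in [4],
  (2.15)–(2.17), and we obtain the formula Rf = (I − G′Q′\*(Q′G′²Q′\*)^{−1}Q′G′)f, (3.25) where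
  G′ = G′(U) = (Δ′_a)^{−1}. We do not know yet if the operators in the above"* [formula are well defined …; this is
  Theorem 3.11, p. 416: *"the operators Δ′_a, G′, (Q′G′²Q′\*)^{−1}, Δ_a, G are positive definite"*].
  Here [3] = `Balaban1984PropagatorsI` (B5), whose (1.42)–(1.44) algebra is kernel-checked in the sibling
  `B5Projector144` (adversarial reader adv4-g11: abstract real inner-product spaces, SCALAR a, `GreenData`, `R144`,
  `lambda0`, `inf_142`, `R144_indep`), and [4] = `Balaban1984PropagatorsII` (B6), (2.15)–(2.17) (certified by hand, cell
  GAPS C-B6-2).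

TYPING (as `B5Projector144` / `B9FrakGPos`: dimension-free linear algebra over two abstract real inner-product spaces).
`E` ⊇ L²(Ω₀, 𝔤) (the space R acts on; the constant weight η^d of the printed scalar product does not change
orthogonality), `F` = L²(𝔅) (target of Q′).  `Δ` = Δ^η_U↾Ω₀ : E →ₗ E (symmetric, (3.23); Dirichlet — NO zero mode, so
none of B5's `LapData`/`AvgData`/`proj1` apparatus is needed), `q` = Q′ : E →ₗ F ((3.18)–(3.19); its scalar-model shape is
`B9Eq319Avg.avgOp`), `qs` = Q′\* : F →ₗ E its adjoint (`B9Eq319Avg.injOp`, `avgOp_adjoint`), `A` : F →ₗ F = the operator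
"a" of (3.24) — multiplication by a_j on Λ_j, i.e. LEVEL-DEPENDENT, typed as an arbitrary symmetric operator (B5's
`GreenData` has a scalar `a`; this is the one structural difference between (1.44) and (3.25)), `lapA Δ q qs A` =
Δ′_a = Δ + Q′\*AQ′ ((3.24)), `g` = G′ = (Δ′_a)^{−1}, `c` = (Q′G′²Q′\*)^{−1}.  The printed inputs are ONE hypothesis bundle
`Data Δ q qs A g c` (field by field the quoted sentences: Δ symmetric, Q′\* the adjoint of Q′, a symmetric, G′ the
two-sided inverse of Δ′_a, (Q′G′²Q′\*)^{−1} the two-sided inverse of Q′G′²Q′\*).  EXISTENCE of G′ and (Q′G′²Q′\*)^{−1}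
(Theorem 3.11) is NOT re-proved — exactly as the text defers it ("We do not know yet if the operators … are well
defined").

THE ONE IDEA.  For EVERY operator A, Δ′_a agrees with Δ^η_U on N(Q′) (`lapA_eq_of_ker`: Q′λ = 0 ⇒ Q′\*AQ′λ = 0), so
Δ^η_U N(Q′) = Δ′_a N(Q′) and the B9 system satisfies B5's `GreenData` with Δ := Δ′_a and a := 0 (`Data.greenData`);
every (1.42)–(1.44) theorem of `B5Projector144` then transfers, and the a-dependence disappears from all conclusions.

WHAT THIS FILE CERTIFIES (kernel; value = the p. 394 paragraph "(3.21) … (3.22) … we obtain the formula (3.25)"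
settled for the printed level-dependent a, NOT summit progress).
1. (3.21) LITERALLY.  `Data.R325_fix_iff` / `R325_fix_iff_mem`: {ω : Rω = ω} = Δ^η_U N(Q′) (the submodule `lapKer Δ q` =
   `(ker Q′).map Δ`); `R325_idem`, `R325_symm` (an orthogonal projection); `R325_mem`, `range_R325`: Ran R = Δ^η_U N(Q′)
   exactly; `inner_sub_R325`: f − Rf ⊥ Δ^η_U N(Q′); hence `R325_eq_starProjection`: under `HasOrthogonalProjection`
   (automatic in finite dimension, `R325_eq_starProjection_fd`; the lattice spaces are finite-dimensional) the (3.25)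
   operator EQUALS Mathlib's orthogonal projection `(lapKer Δ q).starProjection` — "R is an orthogonal projection … onto
   the subspace Δ^η_U N(Q′)".  `R325_indep`: R does not depend on (a, G′, (Q′G′²Q′\*)^{−1}) — any two `Data` over the same
   Δ, Q′ give the same operator (B5 p. 26 says this for (1.44); B9 does not say it but (3.21) implies it).
2. (3.22).  `lam0` = λ₀ := G′Rf (= B5's (1.43) `lambda0`): `q_lam0` Q′λ₀ = 0, `R325_eq_lap_lam0` Rf = Δ^η_U λ₀,
   `norm_sq_split_322` ‖f − Δ^η_U λ‖² = ‖Δ^η_U(λ₀ − λ)‖² + ‖f − Rf‖² on N(Q′), `isMin_322` λ₀ minimises, and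
   `lap_eq_of_isMin`: EVERY minimiser λ has Δ^η_U λ = Rf — so "Rf = Δ^η_U λ₀, where λ₀ is A minimum" is well defined
   although λ₀ need not be unique in E (it is unique when Δ^η_U is injective on N(Q′), `lam0_unique`).
3. (3.20) EXPONENT BOOKKEEPING.  `norm_sq_320`: ‖f‖² = ‖f − Rf‖² + ‖Rf‖², i.e. with f = D\*A and
   min_{λ∈N(Q′)}‖D\*A − Δ^η_U λ‖² = ‖f − Rf‖² (item 2) the two exponents of (3.17) combine to −(1/2α)‖RD\*A‖².  The Gaussian
   λ-integral itself ("in the same way as in [3], (1.42)–(1.44)"; Z′) is NOT reproduced (cf. `B9H163.h164_mean` for the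
   analogous mean computation of (3.164)).
NOT HERE: Theorem 3.11 (existence/positivity of G′, (Q′G′²Q′\*)^{−1}); the lattice realisation of E, F, Δ^η_U, Q′ (the
scalar-model shapes of Q′, Q′\* and the adjoint identity are `B9Eq319Avg`; the 𝔤-valued structure is not modelled
anywhere in the b09 kernel modules, D-b09.12); the bounds (3.42)–(3.49).  Elementary linear algebra; [folklore] on the
algebra, [cite:] on the transcribed formulas.  Cell records: GAPS C-B9-27, DIVERGENCE D-b09.18. -/

namespace Literature.MathematicalPhysics.QuantumFieldTheory.Balaban1983to89.B9Eq325Proj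

open B5Projector144

variable {E F : Type*} [NormedAddCommGroup E] [InnerProductSpace ℝ E] [NormedAddCommGroup F]
  [InnerProductSpace ℝ F]

/-! ## §1  The printed objects -/

section Defs

variable (Δ : E →ₗ[ℝ] E) (q : E →ₗ[ℝ] F) (qs : F →ₗ[ℝ] E) (A : F →ₗ[ℝ] F) (g : E →ₗ[ℝ] E) (c : F →ₗ[ℝ] F)

/-- **(3.24)** Δ′_a = Δ^η_U + Q′\*aQ′ with the LEVEL-DEPENDENT a typed as an operator `A` on L²(𝔅) (multiplication by
a_j(L^jη)^{d−2}-type weights in print). [cite: Balaban1985BackgroundPropagators, (3.24) p.394] -/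
def lapA : E →ₗ[ℝ] E := Δ + qs ∘ₗ A ∘ₗ q

/-- Unfolding of `lapA`: Δ′_aλ = Δ^η_U λ + Q′\*(a(Q′λ)). [folklore] -/
theorem lapA_apply (x : E) : lapA Δ q qs A x = Δ x + qs (A (q x)) := rfl

/-- **(3.25)** "Rf = (I − G′Q′\*(Q′G′²Q′\*)^{−1}Q′G′)f" — the same expression as B5 (1.44) (`B5Projector144.R144`) in
G′ = `g`, (Q′G′²Q′\*)^{−1} = `c`. [cite: Balaban1985BackgroundPropagators, (3.25) p.394] -/
def R325 : E →ₗ[ℝ] E := R144 q qs g c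

/-- `R325` is `B5Projector144.R144` (definitionally). [folklore] -/
theorem R325_eq_R144 : R325 q qs g c = R144 q qs g c := rfl

/-- Unfolding of (3.25): Rf = f − G′Q′\*(Q′G′²Q′\*)^{−1}Q′G′f. [cite: Balaban1985BackgroundPropagators, (3.25) p.394] -/
theorem R325_apply (f : E) : R325 q qs g c f = f - g (qs (c (q (g f)))) := rfl

/-- The minimiser of **(3.22)** as a linear map of f: λ₀ = G′Rf (= B5 (1.43), `B5Projector144.lambda0`).
[cite: Balaban1985BackgroundPropagators, (3.22) p.394; Balaban1984PropagatorsI, (1.43) p.25] -/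
def lam0 : E →ₗ[ℝ] E := g ∘ₗ R325 q qs g c

/-- Unfolding of `lam0`. [folklore] -/
theorem lam0_apply (f : E) : lam0 q qs g c f = g (R325 q qs g c f) := rfl

/-- `lam0` is B5's (1.43) `lambda0`. [folklore] -/
theorem lam0_eq_lambda0 : lam0 q qs g c = lambda0 q qs g c := by
  apply LinearMap.ext
  intro f
  rw [lam0_apply, lambda0_eq_g_R144, R325_eq_R144]

/-- **(3.21)** the subspace "R = Δ^η_U N(Q′), N(Q′) = {λ : Q′λ = 0}" as a submodule: the image of ker Q′ under Δ^η_U.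
[cite: Balaban1985BackgroundPropagators, (3.21) p.394] -/
def lapKer : Submodule ℝ E := (LinearMap.ker q).map Δ

/-- Membership in Δ^η_U N(Q′): ω = Δ^η_U λ with Q′λ = 0. [folklore] -/
theorem mem_lapKer (ω : E) : ω ∈ lapKer Δ q ↔ ∃ l : E, q l = 0 ∧ ω = Δ l := by
  simp only [lapKer, Submodule.mem_map, LinearMap.mem_ker]
  constructor
  · rintro ⟨l, hl, rfl⟩
    exact ⟨l, hl, rfl⟩
  · rintro ⟨l, hl, rfl⟩
    exact ⟨l, hl, rfl⟩

/-- For EVERY operator a: Δ′_a agrees with Δ^η_U on N(Q′) (Q′λ = 0 ⇒ Q′\*aQ′λ = 0) — the reason (3.21)'s Δ^η_U N(Q′)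
equals Δ′_a N(Q′) and the a_j of (3.24) never enter the conclusions below (p. 394: "By the definition of space N(Q′)
the functions λ in (3.22) vanish on Ω₁ᶜ" is the lattice shadow of the same remark). [folklore] -/
theorem lapA_eq_of_ker (l : E) (hl : q l = 0) : lapA Δ q qs A l = Δ l := by
  rw [lapA_apply, hl, map_zero, map_zero, add_zero]

end Defs

/-- THE PRINTED INPUTS of pp. 393–394 as one hypothesis bundle: Δ^η_U = D\*D symmetric ((3.23)), Q′\* the adjoint of
Q′ in the scalar products of L²(Ω₀, 𝔤), L²(𝔅) (p. 393), a symmetric (multiplication by the positive numbers a_j,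
(3.24)), G′ = (Δ′_a)^{−1} (p. 394 "Its inverse is denoted by G′"), (Q′G′²Q′\*)^{−1} the inverse appearing in (3.25).
Existence is Theorem 3.11 and is NOT part of the bundle's content — the bundle only NAMES the inverses.
[cite: Balaban1985BackgroundPropagators, (3.23)-(3.25) p.394] -/
structure Data (Δ : E →ₗ[ℝ] E) (q : E →ₗ[ℝ] F) (qs : F →ₗ[ℝ] E) (A : F →ₗ[ℝ] F) (g : E →ₗ[ℝ] E)
    (c : F →ₗ[ℝ] F) : Prop where
  lap_symm : ∀ x y : E, inner ℝ (Δ x) y = inner ℝ x (Δ y)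
  adj : ∀ (x : E) (φ : F), inner ℝ (q x) φ = inner ℝ x (qs φ)
  A_symm : ∀ φ ψ : F, inner ℝ (A φ) ψ = inner ℝ φ (A ψ)
  g_left : ∀ x : E, g (lapA Δ q qs A x) = x
  g_right : ∀ x : E, lapA Δ q qs A (g x) = x
  c_left : ∀ φ : F, c (q (g (g (qs φ)))) = φ
  c_right : ∀ φ : F, q (g (g (qs (c φ)))) = φ

namespace Data

variable {Δ : E →ₗ[ℝ] E} {q : E →ₗ[ℝ] F} {qs : F →ₗ[ℝ] E} {A : F →ₗ[ℝ] F} {g : E →ₗ[ℝ] E} {c : F →ₗ[ℝ] F}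

/-! ## §2  Transfer to B5's `GreenData` (a := 0, Δ := Δ′_a) -/

/-- Δ′_a is symmetric (Δ^η_U symmetric, a symmetric, Q′\* adjoint to Q′). [folklore] -/
theorem lapA_symm (h : Data Δ q qs A g c) (x y : E) :
    inner ℝ (lapA Δ q qs A x) y = inner ℝ x (lapA Δ q qs A y) := by
  rw [lapA_apply, lapA_apply, inner_add_left, inner_add_right, h.lap_symm, adj_symm h.adj, h.A_symm, h.adj]

/-- The B9 system is a B5 `GreenData` system for the operator Δ′_a with parameter a = 0. [folklore] -/
theorem greenData (h : Data Δ q qs A g c) : GreenData (lapA Δ q qs A) q qs 0 g c where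
  g_left x := by rw [zero_smul, add_zero]; exact h.g_left x
  g_right x := by rw [zero_smul, add_zero]; exact h.g_right x
  c_left := h.c_left
  c_right := h.c_right

/-- G′ is symmetric. [folklore] -/
theorem g_symm (h : Data Δ q qs A g c) (x y : E) : inner ℝ (g x) y = inner ℝ x (g y) :=
  h.greenData.symm h.lapA_symm h.adj x y

/-- G′Δ^η_U λ = λ for Q′λ = 0 (on N(Q′), G′ inverts Δ^η_U itself). [folklore] -/
theorem g_lap (h : Data Δ q qs A g c) (l : E) (hl : q l = 0) : g (Δ l) = l := by
  have h1 := h.g_left l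
  rwa [lapA_eq_of_ker Δ q qs A l hl] at h1

/-- Δ^η_U G′ω = ω when Q′G′ω = 0. [folklore] -/
theorem lap_g (h : Data Δ q qs A g c) (ω : E) (hω : q (g ω) = 0) : Δ (g ω) = ω := by
  have h1 := h.g_right ω
  rwa [lapA_eq_of_ker Δ q qs A (g ω) hω] at h1

/-! ## §3  (3.21): R is the orthogonal projection onto Δ^η_U N(Q′) -/

/-- **(3.21)**, fixed vectors: Rω = ω ⟺ ω = Δ^η_U λ for some λ with Q′λ = 0.
[cite: Balaban1985BackgroundPropagators, (3.21) p.394] -/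
theorem R325_fix_iff (h : Data Δ q qs A g c) (ω : E) :
    R325 q qs g c ω = ω ↔ ∃ l : E, q l = 0 ∧ ω = Δ l := by
  rw [R325_eq_R144, R144_fix_iff_exists h.greenData]
  constructor
  · rintro ⟨l, hl, rfl⟩
    exact ⟨l, hl, lapA_eq_of_ker Δ q qs A l hl⟩
  · rintro ⟨l, hl, rfl⟩
    exact ⟨l, hl, (lapA_eq_of_ker Δ q qs A l hl).symm⟩

/-- (3.21), submodule form: Rω = ω ⟺ ω ∈ Δ^η_U N(Q′). [cite: Balaban1985BackgroundPropagators, (3.21) p.394] -/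
theorem R325_fix_iff_mem (h : Data Δ q qs A g c) (ω : E) : R325 q qs g c ω = ω ↔ ω ∈ lapKer Δ q := by
  rw [mem_lapKer]
  exact h.R325_fix_iff ω

/-- RΔ^η_U λ = Δ^η_U λ for λ ∈ N(Q′). [folklore] -/
theorem R325_lap (h : Data Δ q qs A g c) (l : E) (hl : q l = 0) : R325 q qs g c (Δ l) = Δ l :=
  (h.R325_fix_iff _).mpr ⟨l, hl, rfl⟩

/-- R is idempotent. [folklore] -/
theorem R325_idem (h : Data Δ q qs A g c) (f : E) : R325 q qs g c (R325 q qs g c f) = R325 q qs g c f :=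
  R144_idem h.greenData f

/-- R is symmetric in L²(Ω₀, 𝔤) — with `R325_idem`: "R = R(U) is an orthogonal projection".
[cite: Balaban1985BackgroundPropagators, p.394 (before (3.21))] -/
theorem R325_symm (h : Data Δ q qs A g c) (x y : E) :
    inner ℝ (R325 q qs g c x) y = inner ℝ x (R325 q qs g c y) :=
  R144_symm h.greenData h.lapA_symm h.adj x y

/-- Ran R ⊆ Δ^η_U N(Q′): every Rf lies in the subspace (3.21). [folklore] -/
theorem R325_mem (h : Data Δ q qs A g c) (f : E) : R325 q qs g c f ∈ lapKer Δ q :=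
  (h.R325_fix_iff_mem _).mp (h.R325_idem f)

/-- "onto the subspace R = Δ^η_U N(Q′)": Ran R = Δ^η_U N(Q′) exactly. [cite: Balaban1985BackgroundPropagators, (3.21) p.394] -/
theorem range_R325 (h : Data Δ q qs A g c) : LinearMap.range (R325 q qs g c) = lapKer Δ q := by
  apply le_antisymm
  · rintro ω ⟨f, rfl⟩
    exact h.R325_mem f
  · intro ω hω
    exact ⟨ω, (h.R325_fix_iff_mem ω).mpr hω⟩

/-- f − Rf ⊥ Δ^η_U N(Q′) (orthogonality of the projection). [folklore] -/
theorem inner_sub_R325 (h : Data Δ q qs A g c) (f ω : E) (hω : ω ∈ lapKer Δ q) :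
    inner ℝ (f - R325 q qs g c f) ω = 0 := by
  have hfix : R325 q qs g c ω = ω := (h.R325_fix_iff_mem ω).mpr hω
  rw [← hfix, ← h.R325_symm, map_sub, h.R325_idem, sub_self, inner_zero_left]

/-- **(3.21) AS STATED**: the (3.25) operator equals THE orthogonal projection of L²(Ω₀, 𝔤) onto Δ^η_U N(Q′) (Mathlib's
`Submodule.starProjection`), whenever that projection exists (`HasOrthogonalProjection`; automatic in finite dimension).
[cite: Balaban1985BackgroundPropagators, (3.21)+(3.25) p.394] -/
theorem R325_eq_starProjection (h : Data Δ q qs A g c) [(lapKer Δ q).HasOrthogonalProjection] (f : E) :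
    (lapKer Δ q).starProjection f = R325 q qs g c f :=
  Submodule.eq_starProjection_of_mem_of_inner_eq_zero (h.R325_mem f) (fun w hw => h.inner_sub_R325 f w hw)

/-- `R325_eq_starProjection` as an identity of linear operators. [cite: Balaban1985BackgroundPropagators, (3.21)+(3.25) p.394] -/
theorem starProjection_eq_R325 (h : Data Δ q qs A g c) [(lapKer Δ q).HasOrthogonalProjection] :
    ((lapKer Δ q).starProjection : E →ₗ[ℝ] E) = R325 q qs g c :=
  LinearMap.ext fun f => h.R325_eq_starProjection f

/-- The finite-dimensional case (the lattice spaces L²(Ω₀, 𝔤) are finite-dimensional): no extra instance needed.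
[cite: Balaban1985BackgroundPropagators, (3.21)+(3.25) p.394] -/
theorem R325_eq_starProjection_fd [FiniteDimensional ℝ E] (h : Data Δ q qs A g c) (f : E) :
    (lapKer Δ q).starProjection f = R325 q qs g c f :=
  h.R325_eq_starProjection f

/-- R is INDEPENDENT of (a, G′, (Q′G′²Q′\*)^{−1}): two systems of printed inputs over the same Δ^η_U, Q′, Q′\* give the
same operator (3.25) — an orthogonal projection is determined by its fixed space (B5 p. 26 states this for (1.44)).
[folklore] -/
theorem R325_indep {A' : F →ₗ[ℝ] F} {g' : E →ₗ[ℝ] E} {c' : F →ₗ[ℝ] F} (h : Data Δ q qs A g c)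
    (h' : Data Δ q qs A' g' c') : R325 q qs g c = R325 q qs g' c' :=
  eq_of_symm_idem_fix h.R325_idem h'.R325_idem h.R325_symm h'.R325_symm
    (fun x => by rw [h.R325_fix_iff, h'.R325_fix_iff])

/-! ## §4  (3.22): Rf = Δ^η_U λ₀ with λ₀ minimising ‖f − Δ^η_U λ‖² over N(Q′) -/

/-- Q′λ₀ = 0: λ₀ = G′Rf lies in N(Q′). [folklore] -/
theorem q_lam0 (h : Data Δ q qs A g c) (f : E) : q (lam0 q qs g c f) = 0 :=
  (R144_fix_iff h.greenData _).mp (h.R325_idem f)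

/-- **(3.22)** "Rf = Δ^η_U λ₀". [cite: Balaban1985BackgroundPropagators, (3.22) p.394] -/
theorem R325_eq_lap_lam0 (h : Data Δ q qs A g c) (f : E) : R325 q qs g c f = Δ (lam0 q qs g c f) :=
  (h.lap_g _ (h.q_lam0 f)).symm

/-- f − Rf = G′Q′\*(Q′G′²Q′\*)^{−1}Q′G′f (= B5's `P144 f`). [folklore] -/
theorem sub_R325 (f : E) : f - R325 q qs g c f = P144 q qs g c f := by
  rw [R325_eq_R144, R144_apply, sub_sub_cancel]

/-- COMPLETING THE SQUARE behind (3.22) ⇒ (3.25): for λ ∈ N(Q′), ‖f − Δ^η_U λ‖² = ‖Δ^η_U(λ₀ − λ)‖² + ‖f − Rf‖².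
[folklore] -/
theorem norm_sq_split_322 (h : Data Δ q qs A g c) (f l : E) (hl : q l = 0) :
    ‖f - Δ l‖ ^ 2 = ‖Δ (lam0 q qs g c f - l)‖ ^ 2 + ‖f - R325 q qs g c f‖ ^ 2 := by
  have h1 := norm_sq_split_142 h.greenData h.lapA_symm h.adj f l hl
  have hql : q (lam0 q qs g c f - l) = 0 := by rw [map_sub, h.q_lam0, hl, sub_zero]
  rw [lapPrime_apply, zero_smul, add_zero, lapA_eq_of_ker Δ q qs A l hl, ← lam0_eq_lambda0,
    lapA_eq_of_ker Δ q qs A _ hql, ← sub_R325] at h1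
  exact h1

/-- **(3.22)** "λ₀ is a minimum of the function λ∈N(Q′), λ → ‖f − Δ^η_U λ‖²". [cite: Balaban1985BackgroundPropagators, (3.22) p.394] -/
theorem isMin_322 (h : Data Δ q qs A g c) (f l : E) (hl : q l = 0) :
    ‖f - Δ (lam0 q qs g c f)‖ ^ 2 ≤ ‖f - Δ l‖ ^ 2 := by
  rw [← h.R325_eq_lap_lam0, h.norm_sq_split_322 f l hl]
  exact le_add_of_nonneg_left (sq_nonneg _)

/-- The minimum VALUE of (3.22) is ‖f − Rf‖². [folklore] -/
theorem min_value_322 (h : Data Δ q qs A g c) (f : E) :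
    ‖f - Δ (lam0 q qs g c f)‖ ^ 2 = ‖f - R325 q qs g c f‖ ^ 2 := by
  rw [← h.R325_eq_lap_lam0]

/-- EVERY minimiser λ of (3.22) has Δ^η_U λ = Rf — so "Rf = Δ^η_U λ₀, where λ₀ is a minimum" defines Rf unambiguously.
[cite: Balaban1985BackgroundPropagators, (3.22) p.394] -/
theorem lap_eq_of_isMin (h : Data Δ q qs A g c) (f l : E) (hl : q l = 0)
    (hmin : ‖f - Δ l‖ ^ 2 ≤ ‖f - Δ (lam0 q qs g c f)‖ ^ 2) : Δ l = R325 q qs g c f := by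
  rw [h.min_value_322, h.norm_sq_split_322 f l hl] at hmin
  have h0 : ‖Δ (lam0 q qs g c f - l)‖ ^ 2 = 0 :=
    le_antisymm (by linarith [sq_nonneg ‖f - R325 q qs g c f‖]) (sq_nonneg _)
  have h1 : Δ (lam0 q qs g c f - l) = 0 := by
    rwa [sq_eq_zero_iff, norm_eq_zero] at h0
  rw [map_sub, sub_eq_zero] at h1
  rw [← h1, h.R325_eq_lap_lam0]

/-- If Δ^η_U is injective on N(Q′) (Dirichlet boundary conditions on Ω₀ᶜ) the minimiser itself is unique: λ = λ₀.
[folklore] -/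
theorem lam0_unique (h : Data Δ q qs A g c) (hinj : ∀ l : E, q l = 0 → Δ l = 0 → l = 0) (f l : E) (hl : q l = 0)
    (hmin : ‖f - Δ l‖ ^ 2 ≤ ‖f - Δ (lam0 q qs g c f)‖ ^ 2) : l = lam0 q qs g c f := by
  have h1 : Δ l = Δ (lam0 q qs g c f) := by rw [h.lap_eq_of_isMin f l hl hmin, h.R325_eq_lap_lam0]
  have h2 : Δ (l - lam0 q qs g c f) = 0 := by rw [map_sub, h1, sub_self]
  have h3 : q (l - lam0 q qs g c f) = 0 := by rw [map_sub, hl, h.q_lam0, sub_zero]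
  exact sub_eq_zero.mp (hinj _ h3 h2)

/-! ## §5  (3.20): the exponent -/

/-- ‖f‖² = ‖f − Rf‖² + ‖Rf‖²: with f = D\*A and ‖f − Rf‖² = min_{λ∈N(Q′)}‖D\*A − Δ^η_U λ‖² (`min_value_322`) the two
exponents of (3.17) combine to −(1/2α)‖RD\*A‖², the exponent of **(3.20)** (the Gaussian λ-integral is not reproduced).
[cite: Balaban1985BackgroundPropagators, (3.17) p.393, (3.20) p.394] -/
theorem norm_sq_320 (h : Data Δ q qs A g c) (f : E) :
    ‖f‖ ^ 2 = ‖f - R325 q qs g c f‖ ^ 2 + ‖R325 q qs g c f‖ ^ 2 := by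
  rw [sub_R325, R325_eq_R144]
  exact norm_sq_eq h.greenData h.lapA_symm h.adj f

/-- The (3.20) exponent identity in the printed direction: ‖D\*A‖² − min_λ‖D\*A − Δ^η_U λ‖² = ‖RD\*A‖².
[cite: Balaban1985BackgroundPropagators, (3.20) p.394] -/
theorem exponent_320 (h : Data Δ q qs A g c) (f : E) :
    ‖f‖ ^ 2 - ‖f - Δ (lam0 q qs g c f)‖ ^ 2 = ‖R325 q qs g c f‖ ^ 2 := by
  rw [h.min_value_322, h.norm_sq_320 f, add_sub_cancel_left]

end Data

/-! ## §6  Satisfiability of the bundle (degenerate instance; the non-degenerate ones are Balaban's lattice operators,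
Theorem 3.11) -/

/-- The hypotheses `Data` are jointly satisfiable (E = F = ℝ, Δ = Q′ = Q′\* = id, a = 0, G′ = id, (Q′G′²Q′\*)^{−1} = id);
recorded only to show the bundle is not vacuous. [folklore] -/
theorem data_satisfiable :
    Data (LinearMap.id : ℝ →ₗ[ℝ] ℝ) LinearMap.id LinearMap.id 0 LinearMap.id LinearMap.id where
  lap_symm _ _ := rfl
  adj _ _ := rfl
  A_symm φ ψ := by simp
  g_left x := by simp [lapA_apply]
  g_right x := by simp [lapA_apply]
  c_left _ := rfl
  c_right _ := rfl

end Literature.MathematicalPhysics.QuantumFieldTheory.Balaban1983to89.B9Eq325Proj
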